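/-
Copyright: b2b-lace packet (planner seat CARVER, gen 8). KERNEL PROOF of the arithmetic kernel (K) of
"LEMMA J" (`carver/g8/LEMMA-J.md` §4): the integrality inequality that makes the [FvdH17] N = 1
weighted bound J-free at diagram level despite the pivotal bond. PROGRAMME-INTERNAL: no printed
counterpart exists; NOT CITABLE as literature; carries no verdict and no numerical literal.
-/
import Mathlib

/-!
# The cross-term kernel of the diagram-level weight split ([FvdH17] (BoundNOne)) — kernel proof

CITATION HEADER (PLACEMENT v9). This module belongs to the packet analysing R. Fitzner,
R. van der Hofstad, *Mean-field behavior for nearest-neighbor percolation in `d > 10`*, Electron. J.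
Probab. 22 (2017) no. 43 [FvdH17] (extended version arXiv:1506.07977), proof of Lemma
`lemmapercboundXi1`, eq. (BoundNOne): "`‖x‖₂² ≤ 3(‖w‖₂² + ‖z−w‖₂² + ‖x−z‖₂²)` … we first use this
inequality for each given configuration", and R. Fitzner, R. van der Hofstad, *Generalized approach
to the non-backtracking lace expansion*, PTRF 169 (2017) 1041–1119 [NoBLE17], Lemma 2.13 / (2.35)
(the general weight split with the Cauchy–Schwarz factor `J`). It does NOT reproduce a printed
statement. It proves the one arithmetic fact on which the packet's diagram-level replacement of the
factor `J = 3` by `1` for the `N = 1` bounding diagram rests (LEMMA-J Thm 3; the census entry is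
MARGINS §22 / GAPS G12 add. 5–6 of the packet). Origin: build `lace`, unit `b2b-lace-carver-g8`.

## The mathematics (paper side, for orientation; only (K) below is formalised)

For the `N = 1` bounding ladder (left triangle, square with the pivotal bond on one rail, right
triangle; backbone pieces `Δ₁ = w`, `Δ₂ = z − w`, `Δ₃ = x − z`; rung vectors `r₀ = u − w`,
`r₁ = t − z ∈ ℤ^d`, `s = r₁ − r₀`), conditioning on the rungs makes the pieces independent, the
end triangles have conditional means `−r₀/2`, `r₁/2` (leg exchange symmetry), and the square has
conditional mean `(m(s) − s)/2` where `m(s)` is a convex combination of bond directions, `|m| ≤ 1`.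
The cross term per rung configuration is then `W(M)·(−¼(|r₀|²+|r₁|²+|s|²) + ½⟨m,s⟩)`, and its
non-positivity for EVERY rung configuration is exactly:

(K) for `r₀ r₁ : Fin d → ℤ` and `m : Fin d → ℝ` with `∑ (m i)² ≤ 1`,
    `½ ∑ m i (r₁ i − r₀ i) ≤ ¼ (∑ (r₀ i)² + ∑ (r₁ i)² + ∑ (r₁ i − r₀ i)²)`.

Proof: if `r₀ = r₁` the left side is `0`; else the two integer vectors differ in a coordinate, so
`∑ (r₀ i)² + ∑ (r₁ i)² ≥ 1`, while discrete Cauchy–Schwarz gives `t² ≤ ∑ (r₁ i − r₀ i)²` for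
`t = ∑ m i (r₁ i − r₀ i)`, and `2t ≤ 1 + t²`. The integrality (`≥ 1`) is what absorbs the `O(1)`
drift of the pivotal bond; over `ℝ^d` (K) is false (take `r₀ = 0`, `r₁ = s` small, `m = s/|s|`).

## Main theorems

* `one_le_sumSq_add_sumSq_of_ne` — distinct integer vectors: `1 ≤ ∑ (r₀ i)² + ∑ (r₁ i)²` (in `ℝ`).
* `crossKernel` — (K).
* `crossKernel_budget` — the same with an abstract "square budget" `A ≥ 1` in place of the two
  integer sums (the form used for the boundary cases (ii)/(iii) of LEMMA-J Thm 3 is the trivial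
  `|s| ≤ |s|²` for `s ∈ ℤ^d ∖ {0}`, recorded as `sqrt_sumSq_le_sumSq_of_ne`).
* `pairKernel`, `alignPair`, `crossKernelTwo`, `collapsedKernel` — the pointwise sign kernels of
  the PATH-AVERAGED split (packet Thm 4: the backbone routed along both rails of the ladder with
  probability ½ each): pairs, the two-square ladder, and the collapsed-vertex sub-terms.
-/

namespace Literature.Probability.FitznerVanDerHofstad2017.WeightSplitCrossTerm

open Finset

variable {d : ℕ}

/-- A nonzero integer has square at least one (cast to `ℝ`). Elementary. [folklore] -/
theorem one_le_sq_cast_of_ne_zero (z : ℤ) (hz : z ≠ 0) : (1 : ℝ) ≤ ((z : ℝ)) ^ 2 := by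
  have h1 : (1 : ℤ) ≤ |z| := Int.one_le_abs hz
  have h2 : (1 : ℤ) ≤ z ^ 2 := by nlinarith [h1, sq_abs z, abs_nonneg z]
  exact_mod_cast h2

/-- Two DISTINCT integer vectors have squared norms summing to at least `1`. This is the
integrality input of (K): it fails over `ℝ^d`. Elementary. [folklore] -/
theorem one_le_sumSq_add_sumSq_of_ne (r₀ r₁ : Fin d → ℤ) (h : r₀ ≠ r₁) :
    (1 : ℝ) ≤ ∑ i, ((r₀ i : ℝ)) ^ 2 + ∑ i, ((r₁ i : ℝ)) ^ 2 := by
  obtain ⟨i, hi⟩ := Function.ne_iff.mp h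
  have hs0 : ((r₀ i : ℝ)) ^ 2 ≤ ∑ j, ((r₀ j : ℝ)) ^ 2 :=
    Finset.single_le_sum (f := fun j => ((r₀ j : ℝ)) ^ 2) (fun j _ => sq_nonneg _) (Finset.mem_univ i)
  have hs1 : ((r₁ i : ℝ)) ^ 2 ≤ ∑ j, ((r₁ j : ℝ)) ^ 2 :=
    Finset.single_le_sum (f := fun j => ((r₁ j : ℝ)) ^ 2) (fun j _ => sq_nonneg _) (Finset.mem_univ i)
  have key : (1 : ℝ) ≤ ((r₀ i : ℝ)) ^ 2 + ((r₁ i : ℝ)) ^ 2 := by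
    by_cases h0 : r₀ i = 0
    · have h1 : r₁ i ≠ 0 := fun h1 => hi (by rw [h0, h1])
      have := one_le_sq_cast_of_ne_zero (r₁ i) h1
      nlinarith [sq_nonneg ((r₀ i : ℝ))]
    · have := one_le_sq_cast_of_ne_zero (r₀ i) h0
      nlinarith [sq_nonneg ((r₁ i : ℝ))]
  linarith

/-- For a nonzero integer vector `s`, `|s| ≤ |s|²`, in the sum-of-squares form
`√(∑ sᵢ²) ≤ ∑ sᵢ²` (used for the boundary cases of LEMMA-J Thm 3). Elementary. [folklore] -/
theorem sqrt_sumSq_le_sumSq_of_ne_zero (s : Fin d → ℤ) (hs : s ≠ 0) :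
    Real.sqrt (∑ i, ((s i : ℝ)) ^ 2) ≤ ∑ i, ((s i : ℝ)) ^ 2 := by
  obtain ⟨i, hi⟩ := Function.ne_iff.mp hs
  have h1 : (1 : ℝ) ≤ ∑ j, ((s j : ℝ)) ^ 2 :=
    le_trans (one_le_sq_cast_of_ne_zero (s i) hi)
      (Finset.single_le_sum (f := fun j => ((s j : ℝ)) ^ 2) (fun j _ => sq_nonneg _) (Finset.mem_univ i))
  set S := ∑ j, ((s j : ℝ)) ^ 2 with hS
  have hS0 : 0 ≤ S := le_trans zero_le_one h1
  have hq : 1 ≤ Real.sqrt S := by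
    rw [show (1 : ℝ) = Real.sqrt 1 from Real.sqrt_one.symm]
    exact Real.sqrt_le_sqrt h1
  calc Real.sqrt S = Real.sqrt S * 1 := (mul_one _).symm
    _ ≤ Real.sqrt S * Real.sqrt S := mul_le_mul_of_nonneg_left hq (Real.sqrt_nonneg S)
    _ = S := Real.mul_self_sqrt hS0

/-- **(K) with an abstract budget.** If `t² ≤ S` (Cauchy–Schwarz for the drift against the
discrepancy), `0 ≤ S`, and the "end budget" satisfies `1 ≤ A`, then `½ t ≤ ¼ (A + S)`.
Elementary (AM–GM). [folklore] -/
theorem crossKernel_budget (t A S : ℝ) (ht : t ^ 2 ≤ S) (hA : 1 ≤ A) :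
    (1 / 2 : ℝ) * t ≤ (1 / 4 : ℝ) * (A + S) := by
  nlinarith [sq_nonneg (t - 1)]

/-- **(K), the cross-term kernel of LEMMA J** (packet `carver/g8/LEMMA-J.md` Thm 3): for integer
rung vectors `r₀, r₁` and any real drift vector `m` of Euclidean norm at most one,
`½ ⟨m, r₁ − r₀⟩ ≤ ¼ (|r₀|² + |r₁|² + |r₁ − r₀|²)`. Elementary inequality, first isolated in
the packet (no printed source; programme-internal, not citable as literature). [folklore] -/
theorem crossKernel (r₀ r₁ : Fin d → ℤ) (m : Fin d → ℝ) (hm : ∑ i, (m i) ^ 2 ≤ 1) :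
    (1 / 2 : ℝ) * ∑ i, m i * ((r₁ i - r₀ i : ℤ) : ℝ)
      ≤ (1 / 4 : ℝ) * (∑ i, ((r₀ i : ℝ)) ^ 2 + ∑ i, ((r₁ i : ℝ)) ^ 2
          + ∑ i, (((r₁ i - r₀ i : ℤ) : ℝ)) ^ 2) := by
  by_cases h : r₀ = r₁
  · subst h
    have hz : ∑ i : Fin d, (((r₀ i - r₀ i : ℤ) : ℝ)) ^ 2 = 0 := by simp
    have hz' : ∑ i : Fin d, m i * (((r₀ i - r₀ i : ℤ) : ℝ)) = 0 := by simp
    rw [hz, hz']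
    have h0 : 0 ≤ ∑ i, ((r₀ i : ℝ)) ^ 2 := Finset.sum_nonneg (fun i _ => sq_nonneg _)
    nlinarith [h0]
  · have hA := one_le_sumSq_add_sumSq_of_ne r₀ r₁ h
    have cs := Finset.sum_mul_sq_le_sq_mul_sq (Finset.univ : Finset (Fin d)) m
      (fun i => (((r₁ i - r₀ i : ℤ) : ℝ)))
    have hS0 : 0 ≤ ∑ i, (((r₁ i - r₀ i : ℤ) : ℝ)) ^ 2 := Finset.sum_nonneg (fun i _ => sq_nonneg _)
    have hm0 : 0 ≤ ∑ i, (m i) ^ 2 := Finset.sum_nonneg (fun i _ => sq_nonneg _)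
    have ht : (∑ i, m i * (((r₁ i - r₀ i : ℤ) : ℝ))) ^ 2 ≤ ∑ i, (((r₁ i - r₀ i : ℤ) : ℝ)) ^ 2 := by
      calc (∑ i, m i * (((r₁ i - r₀ i : ℤ) : ℝ))) ^ 2
          ≤ (∑ i, (m i) ^ 2) * ∑ i, (((r₁ i - r₀ i : ℤ) : ℝ)) ^ 2 := cs
        _ ≤ 1 * ∑ i, (((r₁ i - r₀ i : ℤ) : ℝ)) ^ 2 := by
            exact mul_le_mul_of_nonneg_right hm hS0
        _ = ∑ i, (((r₁ i - r₀ i : ℤ) : ℝ)) ^ 2 := one_mul _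
    have := crossKernel_budget _ _ _ ht hA
    linarith


/-!
## Path-averaged split (packet Thm 4) — the arithmetic cores

Routing the backbone of a bounding ladder along BOTH rails (each with probability ½, rung
pieces inserted at the joints) turns the cross term of the additive split into a function of the
symmetrised rail drifts `γ_i` (`|γ_i| ≤ ½`, `γ_i = 0` when the rung discrepancy `s_i` vanishes)
and the integer rung data.  The three elementary inequalities below are the pointwise sign
statements used in the packet (`carver/g8/LEMMA-J.md` §4b): pairs (Cor 3b), the two-square
ladder (Cor 4a) and the collapsed-vertex sub-terms (Cor 4c).  Programme-internal, NOT CITABLE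
as literature; no verdict and no numerical constant of the programme is encoded here.
-/

/-- A nonzero integer vector has squared norm at least one (cast to `ℝ`). Elementary. [folklore] -/
theorem one_le_sumSq_of_ne_zero (s : Fin d → ℤ) (hs : s ≠ 0) :
    (1 : ℝ) ≤ ∑ i, ((s i : ℝ)) ^ 2 := by
  have h := one_le_sumSq_add_sumSq_of_ne s 0 hs
  simpa using h

/-- **Pairs kernel** (packet Cor 3b): for a real vector `γ` with `|γ| ≤ ½` and an integer vector
`s`, `⟨γ, s⟩ ≤ ½ |s|²`.  (Cauchy–Schwarz plus `|s| ≤ |s|²` for integer vectors.) [folklore] -/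
theorem pairKernel (γ : Fin d → ℝ) (hγ : ∑ i, (γ i) ^ 2 ≤ 1 / 4) (s : Fin d → ℤ) :
    ∑ i, γ i * ((s i : ℝ)) ≤ (1 / 2 : ℝ) * ∑ i, ((s i : ℝ)) ^ 2 := by
  by_cases hs : s = 0
  · subst hs; simp
  · have hS := one_le_sumSq_of_ne_zero s hs
    have cs := Finset.sum_mul_sq_le_sq_mul_sq (Finset.univ : Finset (Fin d)) γ (fun i => ((s i : ℝ)))
    have hS0 : 0 ≤ ∑ i, ((s i : ℝ)) ^ 2 := Finset.sum_nonneg (fun i _ => sq_nonneg _)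
    have ht : (2 * ∑ i, γ i * ((s i : ℝ))) ^ 2 ≤ ∑ i, ((s i : ℝ)) ^ 2 := by
      calc (2 * ∑ i, γ i * ((s i : ℝ))) ^ 2 = 4 * (∑ i, γ i * ((s i : ℝ))) ^ 2 := by ring
        _ ≤ 4 * ((∑ i, (γ i) ^ 2) * ∑ i, ((s i : ℝ)) ^ 2) := by linarith [cs]
        _ ≤ 4 * ((1 / 4 : ℝ) * ∑ i, ((s i : ℝ)) ^ 2) := by
            have := mul_le_mul_of_nonneg_right hγ hS0
            linarith
        _ = ∑ i, ((s i : ℝ)) ^ 2 := by ring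
    have := crossKernel_budget _ _ _ ht hS
    linarith

/-- **Alignment bound for two squares** (packet Cor 4a, the core): two drift vectors of norm at
most `½` align by at most `½ ≤ ¼ (|s₁|² + |s₂|²)` when both integer rung discrepancies are
nonzero. Elementary. [folklore] -/
theorem alignPair (γ₁ γ₂ : Fin d → ℝ) (h₁ : ∑ i, (γ₁ i) ^ 2 ≤ 1 / 4) (h₂ : ∑ i, (γ₂ i) ^ 2 ≤ 1 / 4)
    (s₁ s₂ : Fin d → ℤ) (hs₁ : s₁ ≠ 0) (hs₂ : s₂ ≠ 0) :
    2 * ∑ i, γ₁ i * γ₂ i ≤ (1 / 4 : ℝ) * (∑ i, ((s₁ i : ℝ)) ^ 2 + ∑ i, ((s₂ i : ℝ)) ^ 2) := by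
  have hab : 2 * ∑ i, γ₁ i * γ₂ i ≤ ∑ i, (γ₁ i) ^ 2 + ∑ i, (γ₂ i) ^ 2 := by
    rw [Finset.mul_sum, ← Finset.sum_add_distrib]
    exact Finset.sum_le_sum (fun i _ => by nlinarith [sq_nonneg (γ₁ i - γ₂ i)])
  have e₁ := one_le_sumSq_of_ne_zero s₁ hs₁
  have e₂ := one_le_sumSq_of_ne_zero s₂ hs₂
  linarith

/-- **Two-square kernel** (packet Cor 4a): with the top/bottom-averaged routing, the cross term of
the `N = 2` bounding ladder is, pointwise in the rung data `(r₀, s₁, s₂, r₂)`,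
`2⟨γ₁, γ₂⟩ − ¼ (|r₀|² + |s₁|² + |s₂|² + |r₂|²) ≤ 0`, where `γ_i` are the symmetrised rail
drifts (`|γ_i| ≤ ½`, and `γ_i = 0` if `s_i = 0`). Elementary. [folklore] -/
theorem crossKernelTwo (γ₁ γ₂ : Fin d → ℝ) (h₁ : ∑ i, (γ₁ i) ^ 2 ≤ 1 / 4)
    (h₂ : ∑ i, (γ₂ i) ^ 2 ≤ 1 / 4) (r₀ s₁ s₂ r₂ : Fin d → ℤ)
    (hz₁ : s₁ = 0 → γ₁ = 0) (hz₂ : s₂ = 0 → γ₂ = 0) :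
    2 * ∑ i, γ₁ i * γ₂ i
      ≤ (1 / 4 : ℝ) * (∑ i, ((r₀ i : ℝ)) ^ 2 + ∑ i, ((s₁ i : ℝ)) ^ 2
          + ∑ i, ((s₂ i : ℝ)) ^ 2 + ∑ i, ((r₂ i : ℝ)) ^ 2) := by
  have n₀ : 0 ≤ ∑ i, ((r₀ i : ℝ)) ^ 2 := Finset.sum_nonneg (fun i _ => sq_nonneg _)
  have n₁ : 0 ≤ ∑ i, ((s₁ i : ℝ)) ^ 2 := Finset.sum_nonneg (fun i _ => sq_nonneg _)
  have n₂ : 0 ≤ ∑ i, ((s₂ i : ℝ)) ^ 2 := Finset.sum_nonneg (fun i _ => sq_nonneg _)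
  have n₃ : 0 ≤ ∑ i, ((r₂ i : ℝ)) ^ 2 := Finset.sum_nonneg (fun i _ => sq_nonneg _)
  by_cases hs₁ : s₁ = 0
  · have : γ₁ = 0 := hz₁ hs₁
    subst this; simp only [Pi.zero_apply, zero_mul, Finset.sum_const_zero, mul_zero]
    nlinarith
  by_cases hs₂ : s₂ = 0
  · have : γ₂ = 0 := hz₂ hs₂
    subst this; simp only [Pi.zero_apply, mul_zero, Finset.sum_const_zero]
    nlinarith
  have := alignPair γ₁ γ₂ h₁ h₂ s₁ s₂ hs₁ hs₂
  linarith

/-- **Collapsed-vertex kernel** (packet Cor 4c): for a real vector `γ` with `|γ| ≤ ½` and integer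
vectors `s, r`, `⟨γ, r⟩ ≤ ½ (|s|² + ⟨s, r⟩ + |r|²)`.  Proof: `|s|² + ⟨s,r⟩ + |r|² =
½ (|s|² + |r|² + |s + r|²) ≥ ½ (|r|² + 1)` when `r ≠ 0` (then `s` and `s + r` are distinct
integer vectors), and `⟨γ, r⟩ ≤ ½|r| ≤ ¼ (|r|² + 1)`. Elementary. [folklore] -/
theorem collapsedKernel (γ : Fin d → ℝ) (hγ : ∑ i, (γ i) ^ 2 ≤ 1 / 4) (s r : Fin d → ℤ) :
    ∑ i, γ i * ((r i : ℝ))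
      ≤ (1 / 2 : ℝ) * (∑ i, ((s i : ℝ)) ^ 2 + ∑ i, ((s i : ℝ)) * ((r i : ℝ))
          + ∑ i, ((r i : ℝ)) ^ 2) := by
  by_cases hr : r = 0
  · subst hr
    have n : 0 ≤ ∑ i, ((s i : ℝ)) ^ 2 := Finset.sum_nonneg (fun i _ => sq_nonneg _)
    have hz1 : ∑ i, γ i * (((0 : Fin d → ℤ) i : ℝ)) = 0 := by simp
    have hz2 : ∑ i, (((0 : Fin d → ℤ) i : ℝ)) ^ 2 = 0 := by simp
    have hz3 : ∑ i, ((s i : ℝ)) * (((0 : Fin d → ℤ) i : ℝ)) = 0 := by simp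
    rw [hz1, hz2, hz3]
    nlinarith [n]
  · have hne : s ≠ s + r := by
      intro h; apply hr; funext i
      have := congrArg (fun f => f i) h; simp at this; simpa using this
    have hA := one_le_sumSq_add_sumSq_of_ne s (s + r) hne
    have hU : ∑ i, (((s + r) i : ℝ)) ^ 2
        = ∑ i, ((s i : ℝ)) ^ 2 + 2 * ∑ i, ((s i : ℝ)) * ((r i : ℝ)) + ∑ i, ((r i : ℝ)) ^ 2 := by
      rw [Finset.mul_sum, ← Finset.sum_add_distrib, ← Finset.sum_add_distrib]
      refine Finset.sum_congr rfl (fun i _ => ?_)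
      simp only [Pi.add_apply, Int.cast_add]; ring
    have cs := Finset.sum_mul_sq_le_sq_mul_sq (Finset.univ : Finset (Fin d)) γ (fun i => ((r i : ℝ)))
    have hR0 : 0 ≤ ∑ i, ((r i : ℝ)) ^ 2 := Finset.sum_nonneg (fun i _ => sq_nonneg _)
    have ht : (2 * ∑ i, γ i * ((r i : ℝ))) ^ 2 ≤ ∑ i, ((r i : ℝ)) ^ 2 := by
      calc (2 * ∑ i, γ i * ((r i : ℝ))) ^ 2 = 4 * (∑ i, γ i * ((r i : ℝ))) ^ 2 := by ring
        _ ≤ 4 * ((∑ i, (γ i) ^ 2) * ∑ i, ((r i : ℝ)) ^ 2) := by linarith [cs]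
        _ ≤ 4 * ((1 / 4 : ℝ) * ∑ i, ((r i : ℝ)) ^ 2) := by
            have := mul_le_mul_of_nonneg_right hγ hR0
            linarith
        _ = ∑ i, ((r i : ℝ)) ^ 2 := by ring
    have hb := crossKernel_budget _ _ _ ht (le_refl (1 : ℝ))
    -- hb : ½ (2 t) ≤ ¼ (1 + R);  and  S + P + R = ½ (S + R + U) ≥ ½ (R + 1)  by hA, hU
    have hsr : ∑ i, (((s + r) i : ℝ)) ^ 2 = ∑ i, (((s + r) i : ℤ) : ℝ) ^ 2 := by simp
    nlinarith [hb, hA, hU, hR0]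

end Literature.Probability.FitznerVanDerHofstad2017.WeightSplitCrossTerm
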